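import Summits.QuantumFields.BalabanUV.Beta.GAN24.DerivativeRateTransferAnalyticKKT
import Summits.QuantumFields.BalabanUV.Beta.GAN24.DerivativeRateTransferAnalyticMixed

/-!
# `BalabanUV.Beta.GAN24.DerivativeRateTransferAnalyticKKTEnd` — binder row G-an2-4 ∕ (CONV-C), route R6 «VALUES, NOT DERIVATIVES», PART 13:
# THE END IN an1's LETTERS — along the affine TWO-BOND family of bordered data `(s,t) ↦ (H_k + sH₁ₖ + tH₂ₖ, Q_k + sQ₁ₖ + tQ₂ₖ)`, with S2 DISPLAYED
# (the bordered matrix nonsingular and the effective-form entry bounded by ONE `B` on a `k`-uniform bidisc) and S1 (the VALUE rate `c·θ^k` of the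
# effective-form entry on the real square), an1's FIRST B-JET ROWS `dEffForm (H_k) (Q_k) (H₁ₖ) (Q₁ₖ)`, `dEffForm … (H₂ₖ) (Q₂ₖ)` and the MIXED
# two-vertex word `(ℋᴸH₂ − 𝒮Q₂)·dℋ(1) − ℋᴸQ₂ᵀ·d𝒮(1) + (1 ↔ 2)` converge geometrically, with PART 7∕8's explicit exponents
# (unit b2b-balaban-gan24-p3, gen 35; v1)

NOT IN PRINT; OUR PROOF (for the ROUTE; PART 8 `DerivativeRateTransferAnalyticMixed` (`deriv_fst∕snd_step_rateω`, `derivMixed_step_rateω`,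
`exists_secondOrderJet_geometricRate`) + PART 12 `DerivativeRateTransferAnalyticKKT` (the KKT dictionary) BY NAME; [folklore] bookkeeping).
HONEST FRAMING (cell contract, verbatim): «discharging `BetaPertH` makes Bałaban's UV stability UNCONDITIONAL — a real constructive-QFT result; it is
NOT the continuum limit and NOT the Clay problem.»  HONEST DEPENDENCY (verbatim): «continuum YM on T⁴ ⇐ BetaPertH ∧ nine spine estimates (0/9 proved);
BetaPertH ⇐ (D1) ∧ (D4) ∧ CAP+tail; G-an2-4 gates asym, D1 and NE2/3/4.»

WHY THIS FILE.  PARTs 7–11 end in rows `deriv (s ↦ F k (s,0)) 0`, `deriv (t ↦ deriv (s ↦ F k (s,t)) 0) 0` of an abstract entry family `F k`; PART 12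
proved that for `F k (s,t) = 𝒮 (H_k + sH₁ₖ + tH₂ₖ, Q_k + sQ₁ₖ + tQ₂ₖ) i j` (an1's effective form `effForm = −((kkt · ·)⁻¹)₂₂` of the bordered ∕ KKT
matrix `M_k`) these rows ARE an1's (MF′) letters: `dEffForm = ℋᴸ·δH·ℋ − 𝒮·δQ·ℋ − ℋᴸ·δQᵀ·𝒮` (`BorderedJets.dEffForm_eq`) and the polarised two-vertex
word of `minOp_effForm_line_taylor₂` ∕ `neg_jet₂_toBlocks₂₂`.  THIS FILE composes the two: route R6's END for the finite-dimensional model, with the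
route's two debts DISPLAYED as hypotheses and nothing else — (S2) `∀ k, ∀ z ∈ ball 0 ρ ×ˢ ball 0 ρ, IsUnit (kkt (H_k(z)) (Q_k(z))).det` and
`‖𝒮_k(z) i j‖ ≤ B` (ONE radius `ρ`, ONE bound `B`, uniformly in `k` — the CONTENT of [Balaban1985BackgroundPropagators] §B ∕ CMP 99 Thm 3.4 for
Bałaban's operators, NOT claimed), (S1) `‖𝒮_{k+1}(s,t) i j − 𝒮_k(s,t) i j‖ ≤ c·θ^k` on the real square `[0,s₁]²` (the with-background VALUE rate =
NE2-P2's END, NOT claimed).  Index types `ν k`, `μ k` vary with the level `k` (growing lattices); the entry `(i k, j k)` is any level-dependent choice.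

WHAT THIS FILE PROVES (0 sorry, 0 `def`; data `H H₁ H₂ : ∀ k, Matrix (ν k) (ν k) ℂ`, `Q Q₁ Q₂ : ∀ k, Matrix (μ k) (ν k) ℂ`, `i j : ∀ k, μ k`):
* §1 the affine two-bond family on `ℂ × ℂ`: `kkt_affine₂`, `differentiableAt_kkt_affine₂_entry`, **`differentiableAt_kktInv_affine₂_entry`** (PART 12
  `differentiableAt_inv_entry` at `E = ℂ × ℂ`), **`differentiableOn_effForm_affine₂`** ∕ `differentiableOn_minOp_affine₂` ∕ `differentiableOn_flucCov_affine₂` (PART 8's `hF` for the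
  effective-form ∕ minimiser ∕ fluctuation-covariance entries on ANY set where the bordered matrix is nonsingular), the row identifications
  `deriv_effForm_fst ∕ _snd`, `deriv_minOp_fst`, `deriv_flucCov_fst`, and the `Γ`-complement of PART 12's dictionary: `hasDerivAt_dFlucCov_affine`,
  **`deriv_deriv_flucCov_affine₂`** (the MIXED row of `Γ` in an1's letters, `jet₂_toBlocks₁₁` — so all three (MF′) blocks `Γ ∕ Ξ ∕ Σ` have it).
* §2 THE END: **`dEffForm_step_rateω`** (first-order jet row, direction `(H₁,Q₁)`: `‖dEffForm_{k+1} − dEffForm_k‖ ≤ 25·(2B)^r∕(s₁r²)·c^{1−r}·(θ^{1−r})^k`,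
  every `r ∈ ]0,1]`), **`dEffForm_snd_step_rateω`** (direction `(H₂,Q₂)`), `dMinOp_step_rateω` ∕ `dFlucCov_step_rateω` (the `ℋ` ∕ `Γ` first B-jet rows),
  **`mixedWord_step_rateω`** (the polarised two-vertex word:
  `≤ 25·(2·(4B∕ρ))^{r′}∕(s₁r′²)·(25·(2B)^r∕(s₁r²)·c^{1−r})^{1−r′}·((θ^{1−r})^{1−r′})^k`, every `r, r′ ∈ ]0,1]`), and the ∃θ-currency END
  **`exists_effFormJets_geometricRate`** (ONE `(c″, θ″ < 1)` for the three rows at once).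
WHAT IT DOES NOT DO: S1, S2 (displayed), decay ∕ (H2) (PART 9's `convC_*` ENDs take these rows as their rate input — not repeated), the dictionary from
an1's model data to Bałaban's lattice operators ((T-def)) — WHICH `(H,Q)`-family is the background family `B(s,t)` of [B12]'s printed `M_k(B)` is NOT
asserted here (a dictionary to an1's JETS only; gan24-idea-1 W-idea1-g32-1).  SUPPLIER work on route R6 (rank 2, KEEP-AS-REDUCTION, no seat); NEVER «G-an2-4 closed»;
NOT (CONV-C), NOT D1, NOT `BetaPertH`, NOT continuum, NOT Clay.  Records: `HOME/b2b-balaban-gan24-p3/WOODBURY-FIBRE.md` v13.5.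
-/

noncomputable section

namespace Summit.QuantumFields.BalabanUV.Beta.GAN24.DerivativeRateTransferAnalyticKKTEnd

open Matrix Filter Set Metric
open scoped Topology
open Literature.MathematicalPhysics.QuantumFieldTheory.Balaban1983to89.Beta.Composition (kkt)
open Literature.MathematicalPhysics.QuantumFieldTheory.Balaban1983to89.Beta.CompositionSingular (flucCov minOp minOpL effForm)
open Literature.MathematicalPhysics.QuantumFieldTheory.Balaban1983to89.Beta.BorderedJets
  (jet₁ jet₂ dFlucCov dMinOp dMinOpL dEffForm kkt_add kkt_smul jet₂_toBlocks₁₁)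
open Summit.QuantumFields.BalabanUV.Beta.GAN24.DerivativeRateTransferAnalytic (rho_pos)
open Summit.QuantumFields.BalabanUV.Beta.GAN24.DerivativeRateTransferAnalyticMixed
  (isOpen_bidisc deriv_fst_step_rateω deriv_snd_step_rateω derivMixed_step_rateω exists_secondOrderJet_geometricRate)
open Summit.QuantumFields.BalabanUV.Beta.GAN24.DerivativeRateTransferAnalyticKKT
  (hasDerivAt_entry differentiableAt_inv_entry deriv_effForm_affine deriv_minOp_affine deriv_flucCov_affine eventually_isUnit_det_kkt_affine
    hasDerivAt_jet₁_affine deriv_deriv_effForm_affine₂)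

/-! ## §1 The affine two-bond family of bordered data on `ℂ × ℂ` -/

section Affine₂

variable {ν μ : Type*} [Fintype ν] [Fintype μ]
variable (H H₁ H₂ : Matrix ν ν ℂ) (Q Q₁ Q₂ : Matrix μ ν ℂ)

omit [Fintype ν] [Fintype μ] in
/-- [folklore] the bordered matrix is AFFINE on the two-bond parameter space:
`kkt (H + sH₁ + tH₂) (Q + sQ₁ + tQ₂) = kkt H Q + s • kkt H₁ Q₁ + t • kkt H₂ Q₂`. -/
theorem kkt_affine₂ (z : ℂ × ℂ) :
    kkt (H + z.1 • H₁ + z.2 • H₂) (Q + z.1 • Q₁ + z.2 • Q₂) = kkt H Q + z.1 • kkt H₁ Q₁ + z.2 • kkt H₂ Q₂ := by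
  rw [kkt_add, kkt_add, kkt_smul, kkt_smul]

omit [Fintype ν] [Fintype μ] in
/-- [folklore] every entry of the bordered family is (jointly) holomorphic on `ℂ × ℂ` (affine). -/
theorem differentiableAt_kkt_affine₂_entry (z : ℂ × ℂ) (k l : ν ⊕ μ) :
    DifferentiableAt ℂ (fun z : ℂ × ℂ => kkt (H + z.1 • H₁ + z.2 • H₂) (Q + z.1 • Q₁ + z.2 • Q₂) k l) z := by
  simp only [kkt_affine₂, Matrix.add_apply, Matrix.smul_apply, smul_eq_mul]
  fun_prop

variable [DecidableEq ν] [DecidableEq μ]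

/-- **`differentiableAt_kktInv_affine₂_entry`** [our proof; PART 12 BY NAME]: at a point `z` where the bordered matrix is nonsingular, every entry of
`z ↦ (kkt (H + z.1H₁ + z.2H₂) (Q + z.1Q₁ + z.2Q₂))⁻¹` is (jointly) holomorphic. -/
theorem differentiableAt_kktInv_affine₂_entry {z : ℂ × ℂ}
    (hz : IsUnit (kkt (H + z.1 • H₁ + z.2 • H₂) (Q + z.1 • Q₁ + z.2 • Q₂)).det) (k l : ν ⊕ μ) :
    DifferentiableAt ℂ (fun z : ℂ × ℂ => (kkt (H + z.1 • H₁ + z.2 • H₂) (Q + z.1 • Q₁ + z.2 • Q₂))⁻¹ k l) z :=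
  differentiableAt_inv_entry (A := fun z : ℂ × ℂ => kkt (H + z.1 • H₁ + z.2 • H₂) (Q + z.1 • Q₁ + z.2 • Q₂))
    (fun k l => differentiableAt_kkt_affine₂_entry H H₁ H₂ Q Q₁ Q₂ z k l) hz k l

/-- **`differentiableOn_effForm_affine₂` — PART 8's HOLOMORPHY HYPOTHESIS `hF` FOR THE EFFECTIVE-FORM ENTRIES** [our proof]: on any set `U ⊆ ℂ × ℂ`
where the bordered matrix is nonsingular, `z ↦ 𝒮(H + z.1H₁ + z.2H₂, Q + z.1Q₁ + z.2Q₂) i j` is holomorphic. -/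
theorem differentiableOn_effForm_affine₂ {U : Set (ℂ × ℂ)}
    (hU : ∀ z ∈ U, IsUnit (kkt (H + z.1 • H₁ + z.2 • H₂) (Q + z.1 • Q₁ + z.2 • Q₂)).det) (i j : μ) :
    DifferentiableOn ℂ (fun z : ℂ × ℂ => effForm (H + z.1 • H₁ + z.2 • H₂) (Q + z.1 • Q₁ + z.2 • Q₂) i j) U := fun z hz =>
  ((differentiableAt_kktInv_affine₂_entry H H₁ H₂ Q Q₁ Q₂ (hU z hz) (Sum.inr i) (Sum.inr j)).neg).differentiableWithinAt

/-- [our proof] the same for the minimiser entries `z ↦ ℋ(…) i j`. -/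
theorem differentiableOn_minOp_affine₂ {U : Set (ℂ × ℂ)}
    (hU : ∀ z ∈ U, IsUnit (kkt (H + z.1 • H₁ + z.2 • H₂) (Q + z.1 • Q₁ + z.2 • Q₂)).det) (i : ν) (j : μ) :
    DifferentiableOn ℂ (fun z : ℂ × ℂ => minOp (H + z.1 • H₁ + z.2 • H₂) (Q + z.1 • Q₁ + z.2 • Q₂) i j) U := fun z hz =>
  (differentiableAt_kktInv_affine₂_entry H H₁ H₂ Q Q₁ Q₂ (hU z hz) (Sum.inl i) (Sum.inr j)).differentiableWithinAt

/-- [our proof; PART 12 BY NAME] the `s`-ROW at the base point of the two-bond family read through the slice `t = 0` is the `dEffForm (H₁,Q₁)` entry. -/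
theorem deriv_effForm_fst (h : IsUnit (kkt H Q).det) (i j : μ) :
    deriv (fun s : ℂ => effForm (H + s • H₁ + (0 : ℂ) • H₂) (Q + s • Q₁ + (0 : ℂ) • Q₂) i j) 0 = dEffForm H Q H₁ Q₁ i j := by
  simp only [zero_smul, add_zero]
  exact deriv_effForm_affine H H₁ Q Q₁ h i j

/-- [our proof; PART 12 BY NAME] the `t`-ROW read through the slice `s = 0` is the `dEffForm (H₂,Q₂)` entry. -/
theorem deriv_effForm_snd (h : IsUnit (kkt H Q).det) (i j : μ) :
    deriv (fun t : ℂ => effForm (H + (0 : ℂ) • H₁ + t • H₂) (Q + (0 : ℂ) • Q₁ + t • Q₂) i j) 0 = dEffForm H Q H₂ Q₂ i j := by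
  simp only [zero_smul, add_zero]
  exact deriv_effForm_affine H H₂ Q Q₂ h i j

/-- [our proof] the same for the fluctuation-covariance entries `z ↦ 𝒢(…) i j`. -/
theorem differentiableOn_flucCov_affine₂ {U : Set (ℂ × ℂ)}
    (hU : ∀ z ∈ U, IsUnit (kkt (H + z.1 • H₁ + z.2 • H₂) (Q + z.1 • Q₁ + z.2 • Q₂)).det) (i j : ν) :
    DifferentiableOn ℂ (fun z : ℂ × ℂ => flucCov (H + z.1 • H₁ + z.2 • H₂) (Q + z.1 • Q₁ + z.2 • Q₂) i j) U := fun z hz =>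
  (differentiableAt_kktInv_affine₂_entry H H₁ H₂ Q Q₁ Q₂ (hU z hz) (Sum.inl i) (Sum.inl j)).differentiableWithinAt

/-- [our proof; PART 12 BY NAME] the `s`-ROW of a FLUCTUATION-COVARIANCE entry through the slice `t = 0` is the `dFlucCov (H₁,Q₁)` entry. -/
theorem deriv_flucCov_fst (h : IsUnit (kkt H Q).det) (i j : ν) :
    deriv (fun s : ℂ => flucCov (H + s • H₁ + (0 : ℂ) • H₂) (Q + s • Q₁ + (0 : ℂ) • Q₂) i j) 0 = dFlucCov H Q H₁ Q₁ i j := by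
  simp only [zero_smul, add_zero]
  exact deriv_flucCov_affine H H₁ Q Q₁ h i j

/-- [our proof; PART 12's `hasDerivAt_jet₁_affine` read in the `₁₁` block] the `dFlucCov` row along a line has derivative the `₁₁`-read-out of the
polarised second jet. -/
theorem hasDerivAt_dFlucCov_affine (H' : Matrix ν ν ℂ) (Q' : Matrix μ ν ℂ) {s₀ : ℂ}
    (h : IsUnit (kkt (H + s₀ • H₁) (Q + s₀ • Q₁)).det) (i j : ν) :
    HasDerivAt (fun s : ℂ => dFlucCov (H + s • H₁) (Q + s • Q₁) H' Q' i j)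
      ((jet₂ (H + s₀ • H₁) (Q + s₀ • Q₁) H₁ Q₁ H' Q' + jet₂ (H + s₀ • H₁) (Q + s₀ • Q₁) H' Q' H₁ Q₁)
        (Sum.inl i) (Sum.inl j)) s₀ :=
  hasDerivAt_entry (hasDerivAt_jet₁_affine H H₁ Q Q₁ H' Q' h) (Sum.inl i) (Sum.inl j)

/-- **`deriv_deriv_flucCov_affine₂` — THE MIXED u-ROW OF THE FLUCTUATION COVARIANCE `Γ` IN an1's LETTERS** [our proof; complements PART 12's
`deriv_deriv_effForm_affine₂ ∕ _minOp_affine₂` so that ALL THREE (MF′) blocks `Γ ∕ Ξ ∕ Σ` have their mixed row]: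
`∂_t∂_s|₍₀,₀₎ 𝒢 i j = ((−(𝒢H₂ + ℋQ₂)·d𝒢(H₁,Q₁) − 𝒢Q₂ᵀ·dℋᴸ(H₁,Q₁)) + (−(𝒢H₁ + ℋQ₁)·d𝒢(H₂,Q₂) − 𝒢Q₁ᵀ·dℋᴸ(H₂,Q₂))) i j` (`BorderedJets.jet₂_toBlocks₁₁`). -/
theorem deriv_deriv_flucCov_affine₂ (h : IsUnit (kkt H Q).det) (i j : ν) :
    deriv (fun t : ℂ => deriv (fun s : ℂ => flucCov (H + s • H₁ + t • H₂) (Q + s • Q₁ + t • Q₂) i j) 0) 0 =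
      ((-((flucCov H Q * H₂ + minOp H Q * Q₂) * dFlucCov H Q H₁ Q₁) - flucCov H Q * Q₂ᵀ * dMinOpL H Q H₁ Q₁)
        + (-((flucCov H Q * H₁ + minOp H Q * Q₁) * dFlucCov H Q H₂ Q₂) - flucCov H Q * Q₁ᵀ * dMinOpL H Q H₂ Q₂)) i j := by
  have hev : (fun t : ℂ => deriv (fun s : ℂ => flucCov (H + s • H₁ + t • H₂) (Q + s • Q₁ + t • Q₂) i j) 0) =ᶠ[𝓝 (0 : ℂ)]
      fun t : ℂ => dFlucCov (H + t • H₂) (Q + t • Q₂) H₁ Q₁ i j := by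
    refine (eventually_isUnit_det_kkt_affine H H₂ Q Q₂ h).mono fun t ht => ?_
    have hfun : (fun s : ℂ => flucCov (H + s • H₁ + t • H₂) (Q + s • Q₁ + t • Q₂) i j) =
        fun s : ℂ => flucCov (H + t • H₂ + s • H₁) (Q + t • Q₂ + s • Q₁) i j := by
      funext s; rw [add_right_comm H, add_right_comm Q]
    simp only [hfun]
    exact deriv_flucCov_affine (H + t • H₂) H₁ (Q + t • Q₂) Q₁ ht i j
  rw [hev.deriv_eq]
  have h0 : IsUnit (kkt (H + (0 : ℂ) • H₂) (Q + (0 : ℂ) • Q₂)).det := by simpa using h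
  have hd := (hasDerivAt_dFlucCov_affine H H₂ Q Q₂ H₁ Q₁ h0 i j).deriv
  rw [hd, ← jet₂_toBlocks₁₁, ← jet₂_toBlocks₁₁]
  simp only [zero_smul, add_zero, Matrix.add_apply, Matrix.toBlocks₁₁, Matrix.of_apply]

/-- [our proof; PART 12 BY NAME] the `s`-ROW of a MINIMISER entry through the slice `t = 0` is the `dMinOp (H₁,Q₁)` entry. -/
theorem deriv_minOp_fst (h : IsUnit (kkt H Q).det) (i : ν) (j : μ) :
    deriv (fun s : ℂ => minOp (H + s • H₁ + (0 : ℂ) • H₂) (Q + s • Q₁ + (0 : ℂ) • Q₂) i j) 0 = dMinOp H Q H₁ Q₁ i j := by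
  simp only [zero_smul, add_zero]
  exact deriv_minOp_affine H H₁ Q Q₁ h i j

end Affine₂

/-! ## §2 The END: an1's first B-jet rows and the mixed two-vertex word inherit the VALUE rate (S2, S1 displayed) -/

section End

variable {ν μ : ℕ → Type*} [∀ k, Fintype (ν k)] [∀ k, Fintype (μ k)] [∀ k, DecidableEq (ν k)] [∀ k, DecidableEq (μ k)]
variable {H H₁ H₂ : ∀ k, Matrix (ν k) (ν k) ℂ} {Q Q₁ Q₂ : ∀ k, Matrix (μ k) (ν k) ℂ} {i j : ∀ k, μ k} {ρ s₁ B c θ : ℝ}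

/-- [our proof] the base point `(0,0)` lies in the bidisc, so (S2) there gives `IsUnit (kkt (H k) (Q k)).det`. -/
theorem isUnit_det_base (hs₁ : 0 < s₁) (hs₁ρ : s₁ * Real.cosh 1 < ρ)
    (hdet : ∀ k, ∀ z ∈ ball (0 : ℂ) ρ ×ˢ ball (0 : ℂ) ρ,
      IsUnit (kkt (H k + z.1 • H₁ k + z.2 • H₂ k) (Q k + z.1 • Q₁ k + z.2 • Q₂ k)).det) (k : ℕ) :
    IsUnit (kkt (H k) (Q k)).det := by
  have hρ : 0 < ρ := rho_pos hs₁ hs₁ρ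
  have h0 : ((0 : ℂ), (0 : ℂ)) ∈ ball (0 : ℂ) ρ ×ˢ ball (0 : ℂ) ρ := ⟨mem_ball_self hρ, mem_ball_self hρ⟩
  simpa using hdet k ((0 : ℂ), (0 : ℂ)) h0

/-- **`dEffForm_step_rateω` — an1's FIRST B-JET ROW OF THE EFFECTIVE FORM INHERITS THE VALUE RATE** [our proof; PART 8 `deriv_fst_step_rateω` + PART 12]:
with (S2) the bordered matrices `kkt (H_k + sH₁ₖ + tH₂ₖ) (Q_k + sQ₁ₖ + tQ₂ₖ)` nonsingular and `‖𝒮_k(s,t) i j‖ ≤ B` on the bidisc `ball 0 ρ ×ˢ ball 0 ρ`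
(all `k`), and (S1) `‖𝒮_{k+1}(s,t) i j − 𝒮_k(s,t) i j‖ ≤ c·θ^k` on the real square `[0,s₁]²` (`0 < c`, `0 < θ`, `0 < s₁`, `s₁·cosh 1 < ρ`): for every
`r ∈ ]0,1]` and every `k`, `‖dEffForm (H_{k+1}) (Q_{k+1}) (H₁) (Q₁) i j − dEffForm (H_k) (Q_k) (H₁) (Q₁) i j‖ ≤ 25·(2B)^r∕(s₁r²)·c^{1−r}·(θ^{1−r})^k`. -/
theorem dEffForm_step_rateω (hs₁ : 0 < s₁) (hs₁ρ : s₁ * Real.cosh 1 < ρ)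
    (hdet : ∀ k, ∀ z ∈ ball (0 : ℂ) ρ ×ˢ ball (0 : ℂ) ρ,
      IsUnit (kkt (H k + z.1 • H₁ k + z.2 • H₂ k) (Q k + z.1 • Q₁ k + z.2 • Q₂ k)).det)
    (hB : ∀ k, ∀ z ∈ ball (0 : ℂ) ρ ×ˢ ball (0 : ℂ) ρ,
      ‖effForm (H k + z.1 • H₁ k + z.2 • H₂ k) (Q k + z.1 • Q₁ k + z.2 • Q₂ k) (i k) (j k)‖ ≤ B)
    (hrate : ∀ k (s t : ℝ), 0 ≤ s → s ≤ s₁ → 0 ≤ t → t ≤ s₁ →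
      ‖effForm (H (k + 1) + (s : ℂ) • H₁ (k + 1) + (t : ℂ) • H₂ (k + 1)) (Q (k + 1) + (s : ℂ) • Q₁ (k + 1) + (t : ℂ) • Q₂ (k + 1))
          (i (k + 1)) (j (k + 1))
        - effForm (H k + (s : ℂ) • H₁ k + (t : ℂ) • H₂ k) (Q k + (s : ℂ) • Q₁ k + (t : ℂ) • Q₂ k) (i k) (j k)‖ ≤ c * θ ^ k)
    (hc : 0 < c) (hθ : 0 < θ) {r : ℝ} (hr : 0 < r) (hr1 : r ≤ 1) (k : ℕ) :
    ‖dEffForm (H (k + 1)) (Q (k + 1)) (H₁ (k + 1)) (Q₁ (k + 1)) (i (k + 1)) (j (k + 1))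
        - dEffForm (H k) (Q k) (H₁ k) (Q₁ k) (i k) (j k)‖ ≤ 25 * (2 * B) ^ r / (s₁ * r ^ 2) * c ^ (1 - r) * (θ ^ (1 - r)) ^ k := by
  have key := deriv_fst_step_rateω
    (F := fun k (z : ℂ × ℂ) => effForm (H k + z.1 • H₁ k + z.2 • H₂ k) (Q k + z.1 • Q₁ k + z.2 • Q₂ k) (i k) (j k)) hs₁ hs₁ρ
    (fun k => differentiableOn_effForm_affine₂ (H k) (H₁ k) (H₂ k) (Q k) (Q₁ k) (Q₂ k) (hdet k) (i k) (j k)) hB hrate hc hθ hr hr1 k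
  dsimp only at key
  rwa [deriv_effForm_fst (H (k + 1)) (H₁ (k + 1)) (H₂ (k + 1)) (Q (k + 1)) (Q₁ (k + 1)) (Q₂ (k + 1)) (isUnit_det_base hs₁ hs₁ρ hdet (k + 1)),
    deriv_effForm_fst (H k) (H₁ k) (H₂ k) (Q k) (Q₁ k) (Q₂ k) (isUnit_det_base hs₁ hs₁ρ hdet k)] at key

/-- **`dEffForm_snd_step_rateω`** — the same for the SECOND bond direction `(H₂, Q₂)` [our proof; PART 8 `deriv_snd_step_rateω`]. -/
theorem dEffForm_snd_step_rateω (hs₁ : 0 < s₁) (hs₁ρ : s₁ * Real.cosh 1 < ρ)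
    (hdet : ∀ k, ∀ z ∈ ball (0 : ℂ) ρ ×ˢ ball (0 : ℂ) ρ,
      IsUnit (kkt (H k + z.1 • H₁ k + z.2 • H₂ k) (Q k + z.1 • Q₁ k + z.2 • Q₂ k)).det)
    (hB : ∀ k, ∀ z ∈ ball (0 : ℂ) ρ ×ˢ ball (0 : ℂ) ρ,
      ‖effForm (H k + z.1 • H₁ k + z.2 • H₂ k) (Q k + z.1 • Q₁ k + z.2 • Q₂ k) (i k) (j k)‖ ≤ B)
    (hrate : ∀ k (s t : ℝ), 0 ≤ s → s ≤ s₁ → 0 ≤ t → t ≤ s₁ →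
      ‖effForm (H (k + 1) + (s : ℂ) • H₁ (k + 1) + (t : ℂ) • H₂ (k + 1)) (Q (k + 1) + (s : ℂ) • Q₁ (k + 1) + (t : ℂ) • Q₂ (k + 1))
          (i (k + 1)) (j (k + 1))
        - effForm (H k + (s : ℂ) • H₁ k + (t : ℂ) • H₂ k) (Q k + (s : ℂ) • Q₁ k + (t : ℂ) • Q₂ k) (i k) (j k)‖ ≤ c * θ ^ k)
    (hc : 0 < c) (hθ : 0 < θ) {r : ℝ} (hr : 0 < r) (hr1 : r ≤ 1) (k : ℕ) :
    ‖dEffForm (H (k + 1)) (Q (k + 1)) (H₂ (k + 1)) (Q₂ (k + 1)) (i (k + 1)) (j (k + 1))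
        - dEffForm (H k) (Q k) (H₂ k) (Q₂ k) (i k) (j k)‖ ≤ 25 * (2 * B) ^ r / (s₁ * r ^ 2) * c ^ (1 - r) * (θ ^ (1 - r)) ^ k := by
  have key := deriv_snd_step_rateω
    (F := fun k (z : ℂ × ℂ) => effForm (H k + z.1 • H₁ k + z.2 • H₂ k) (Q k + z.1 • Q₁ k + z.2 • Q₂ k) (i k) (j k)) hs₁ hs₁ρ
    (fun k => differentiableOn_effForm_affine₂ (H k) (H₁ k) (H₂ k) (Q k) (Q₁ k) (Q₂ k) (hdet k) (i k) (j k)) hB hrate hc hθ hr hr1 k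
  dsimp only at key
  rwa [deriv_effForm_snd (H (k + 1)) (H₁ (k + 1)) (H₂ (k + 1)) (Q (k + 1)) (Q₁ (k + 1)) (Q₂ (k + 1)) (isUnit_det_base hs₁ hs₁ρ hdet (k + 1)),
    deriv_effForm_snd (H k) (H₁ k) (H₂ k) (Q k) (Q₁ k) (Q₂ k) (isUnit_det_base hs₁ hs₁ρ hdet k)] at key

/-- **`dMinOp_step_rateω` — an1's FIRST B-JET ROW OF THE MINIMISER `dℋ = −𝒢·δH·ℋ − ℋ·δQ·ℋ + 𝒢·δQᵀ·𝒮` INHERITS THE VALUE RATE** [our proof;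
PART 8 `deriv_fst_step_rateω` + PART 12]: the same as `dEffForm_step_rateω` for a MINIMISER entry `ℋ_k(s,t) i j` — (S2) nonsingular + `‖ℋ_k(s,t) i j‖ ≤ B`
on the bidisc, (S1) the value rate of `ℋ_k(s,t) i j` on the real square ⇒ `‖dMinOp (H_{k+1}) (Q_{k+1}) (H₁) (Q₁) i j − dMinOp (H_k) (Q_k) (H₁) (Q₁) i j‖
≤ 25·(2B)^r∕(s₁r²)·c^{1−r}·(θ^{1−r})^k`, every `r ∈ ]0,1]` (here `i : ∀ k, ν k`). -/
theorem dMinOp_step_rateω {i : ∀ k, ν k} (hs₁ : 0 < s₁) (hs₁ρ : s₁ * Real.cosh 1 < ρ)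
    (hdet : ∀ k, ∀ z ∈ ball (0 : ℂ) ρ ×ˢ ball (0 : ℂ) ρ,
      IsUnit (kkt (H k + z.1 • H₁ k + z.2 • H₂ k) (Q k + z.1 • Q₁ k + z.2 • Q₂ k)).det)
    (hB : ∀ k, ∀ z ∈ ball (0 : ℂ) ρ ×ˢ ball (0 : ℂ) ρ,
      ‖minOp (H k + z.1 • H₁ k + z.2 • H₂ k) (Q k + z.1 • Q₁ k + z.2 • Q₂ k) (i k) (j k)‖ ≤ B)
    (hrate : ∀ k (s t : ℝ), 0 ≤ s → s ≤ s₁ → 0 ≤ t → t ≤ s₁ →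
      ‖minOp (H (k + 1) + (s : ℂ) • H₁ (k + 1) + (t : ℂ) • H₂ (k + 1)) (Q (k + 1) + (s : ℂ) • Q₁ (k + 1) + (t : ℂ) • Q₂ (k + 1))
          (i (k + 1)) (j (k + 1))
        - minOp (H k + (s : ℂ) • H₁ k + (t : ℂ) • H₂ k) (Q k + (s : ℂ) • Q₁ k + (t : ℂ) • Q₂ k) (i k) (j k)‖ ≤ c * θ ^ k)
    (hc : 0 < c) (hθ : 0 < θ) {r : ℝ} (hr : 0 < r) (hr1 : r ≤ 1) (k : ℕ) :
    ‖dMinOp (H (k + 1)) (Q (k + 1)) (H₁ (k + 1)) (Q₁ (k + 1)) (i (k + 1)) (j (k + 1))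
        - dMinOp (H k) (Q k) (H₁ k) (Q₁ k) (i k) (j k)‖ ≤ 25 * (2 * B) ^ r / (s₁ * r ^ 2) * c ^ (1 - r) * (θ ^ (1 - r)) ^ k := by
  have key := deriv_fst_step_rateω
    (F := fun k (z : ℂ × ℂ) => minOp (H k + z.1 • H₁ k + z.2 • H₂ k) (Q k + z.1 • Q₁ k + z.2 • Q₂ k) (i k) (j k)) hs₁ hs₁ρ
    (fun k => differentiableOn_minOp_affine₂ (H k) (H₁ k) (H₂ k) (Q k) (Q₁ k) (Q₂ k) (hdet k) (i k) (j k)) hB hrate hc hθ hr hr1 k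
  dsimp only at key
  rwa [deriv_minOp_fst (H (k + 1)) (H₁ (k + 1)) (H₂ (k + 1)) (Q (k + 1)) (Q₁ (k + 1)) (Q₂ (k + 1)) (isUnit_det_base hs₁ hs₁ρ hdet (k + 1)),
    deriv_minOp_fst (H k) (H₁ k) (H₂ k) (Q k) (Q₁ k) (Q₂ k) (isUnit_det_base hs₁ hs₁ρ hdet k)] at key

/-- **`dFlucCov_step_rateω` — an1's FIRST B-JET ROW OF THE FLUCTUATION COVARIANCE `d𝒢 = −𝒢·δH·𝒢 − ℋ·δQ·𝒢 − 𝒢·δQᵀ·ℋᴸ` INHERITS THE VALUE RATE**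
[our proof; PART 8 `deriv_fst_step_rateω` + PART 12]: the `Γ`-twin of `dEffForm_step_rateω` (here `i j : ∀ k, ν k`). -/
theorem dFlucCov_step_rateω {i j : ∀ k, ν k} (hs₁ : 0 < s₁) (hs₁ρ : s₁ * Real.cosh 1 < ρ)
    (hdet : ∀ k, ∀ z ∈ ball (0 : ℂ) ρ ×ˢ ball (0 : ℂ) ρ,
      IsUnit (kkt (H k + z.1 • H₁ k + z.2 • H₂ k) (Q k + z.1 • Q₁ k + z.2 • Q₂ k)).det)
    (hB : ∀ k, ∀ z ∈ ball (0 : ℂ) ρ ×ˢ ball (0 : ℂ) ρ,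
      ‖flucCov (H k + z.1 • H₁ k + z.2 • H₂ k) (Q k + z.1 • Q₁ k + z.2 • Q₂ k) (i k) (j k)‖ ≤ B)
    (hrate : ∀ k (s t : ℝ), 0 ≤ s → s ≤ s₁ → 0 ≤ t → t ≤ s₁ →
      ‖flucCov (H (k + 1) + (s : ℂ) • H₁ (k + 1) + (t : ℂ) • H₂ (k + 1)) (Q (k + 1) + (s : ℂ) • Q₁ (k + 1) + (t : ℂ) • Q₂ (k + 1))
          (i (k + 1)) (j (k + 1))
        - flucCov (H k + (s : ℂ) • H₁ k + (t : ℂ) • H₂ k) (Q k + (s : ℂ) • Q₁ k + (t : ℂ) • Q₂ k) (i k) (j k)‖ ≤ c * θ ^ k)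
    (hc : 0 < c) (hθ : 0 < θ) {r : ℝ} (hr : 0 < r) (hr1 : r ≤ 1) (k : ℕ) :
    ‖dFlucCov (H (k + 1)) (Q (k + 1)) (H₁ (k + 1)) (Q₁ (k + 1)) (i (k + 1)) (j (k + 1))
        - dFlucCov (H k) (Q k) (H₁ k) (Q₁ k) (i k) (j k)‖ ≤ 25 * (2 * B) ^ r / (s₁ * r ^ 2) * c ^ (1 - r) * (θ ^ (1 - r)) ^ k := by
  have key := deriv_fst_step_rateω
    (F := fun k (z : ℂ × ℂ) => flucCov (H k + z.1 • H₁ k + z.2 • H₂ k) (Q k + z.1 • Q₁ k + z.2 • Q₂ k) (i k) (j k)) hs₁ hs₁ρ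
    (fun k => differentiableOn_flucCov_affine₂ (H k) (H₁ k) (H₂ k) (Q k) (Q₁ k) (Q₂ k) (hdet k) (i k) (j k)) hB hrate hc hθ hr hr1 k
  dsimp only at key
  rwa [deriv_flucCov_fst (H (k + 1)) (H₁ (k + 1)) (H₂ (k + 1)) (Q (k + 1)) (Q₁ (k + 1)) (Q₂ (k + 1)) (isUnit_det_base hs₁ hs₁ρ hdet (k + 1)),
    deriv_flucCov_fst (H k) (H₁ k) (H₂ k) (Q k) (Q₁ k) (Q₂ k) (isUnit_det_base hs₁ hs₁ρ hdet k)] at key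

/-- **`mixedWord_step_rateω` — THE MIXED TWO-VERTEX WORD (route R6's `∂_t∂_s` u-ROW, an1's letters) INHERITS THE VALUE RATE** [our proof; PART 8
`derivMixed_step_rateω` + PART 12 `deriv_deriv_effForm_affine₂`]: with `W_k := ((ℋᴸH₂ − 𝒮Q₂)·dℋ(H₁,Q₁) − ℋᴸQ₂ᵀ·d𝒮(H₁,Q₁) + (ℋᴸH₁ − 𝒮Q₁)·dℋ(H₂,Q₂) −
ℋᴸQ₁ᵀ·d𝒮(H₂,Q₂)) i j` at level `k` (blocks of `(H_k, Q_k)`), under (S2), (S1) as in `dEffForm_step_rateω` and `0 < B`: for all `r, r′ ∈ ]0,1]`, every `k`,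
`‖W_{k+1} − W_k‖ ≤ 25·(2·(4B∕ρ))^{r′}∕(s₁r′²)·(25·(2B)^r∕(s₁r²)·c^{1−r})^{1−r′}·((θ^{1−r})^{1−r′})^k`. -/
theorem mixedWord_step_rateω (hs₁ : 0 < s₁) (hs₁ρ : s₁ * Real.cosh 1 < ρ)
    (hdet : ∀ k, ∀ z ∈ ball (0 : ℂ) ρ ×ˢ ball (0 : ℂ) ρ,
      IsUnit (kkt (H k + z.1 • H₁ k + z.2 • H₂ k) (Q k + z.1 • Q₁ k + z.2 • Q₂ k)).det)
    (hB : ∀ k, ∀ z ∈ ball (0 : ℂ) ρ ×ˢ ball (0 : ℂ) ρ,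
      ‖effForm (H k + z.1 • H₁ k + z.2 • H₂ k) (Q k + z.1 • Q₁ k + z.2 • Q₂ k) (i k) (j k)‖ ≤ B) (hB0 : 0 < B)
    (hrate : ∀ k (s t : ℝ), 0 ≤ s → s ≤ s₁ → 0 ≤ t → t ≤ s₁ →
      ‖effForm (H (k + 1) + (s : ℂ) • H₁ (k + 1) + (t : ℂ) • H₂ (k + 1)) (Q (k + 1) + (s : ℂ) • Q₁ (k + 1) + (t : ℂ) • Q₂ (k + 1))
          (i (k + 1)) (j (k + 1))
        - effForm (H k + (s : ℂ) • H₁ k + (t : ℂ) • H₂ k) (Q k + (s : ℂ) • Q₁ k + (t : ℂ) • Q₂ k) (i k) (j k)‖ ≤ c * θ ^ k)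
    (hc : 0 < c) (hθ : 0 < θ) {r r' : ℝ} (hr : 0 < r) (hr1 : r ≤ 1) (hr' : 0 < r') (hr'1 : r' ≤ 1) (k : ℕ) :
    ‖(((minOpL (H (k + 1)) (Q (k + 1)) * H₂ (k + 1) - effForm (H (k + 1)) (Q (k + 1)) * Q₂ (k + 1))
            * dMinOp (H (k + 1)) (Q (k + 1)) (H₁ (k + 1)) (Q₁ (k + 1))
          - minOpL (H (k + 1)) (Q (k + 1)) * (Q₂ (k + 1))ᵀ * dEffForm (H (k + 1)) (Q (k + 1)) (H₁ (k + 1)) (Q₁ (k + 1)))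
        + ((minOpL (H (k + 1)) (Q (k + 1)) * H₁ (k + 1) - effForm (H (k + 1)) (Q (k + 1)) * Q₁ (k + 1))
            * dMinOp (H (k + 1)) (Q (k + 1)) (H₂ (k + 1)) (Q₂ (k + 1))
          - minOpL (H (k + 1)) (Q (k + 1)) * (Q₁ (k + 1))ᵀ * dEffForm (H (k + 1)) (Q (k + 1)) (H₂ (k + 1)) (Q₂ (k + 1))))
          (i (k + 1)) (j (k + 1))
      - (((minOpL (H k) (Q k) * H₂ k - effForm (H k) (Q k) * Q₂ k) * dMinOp (H k) (Q k) (H₁ k) (Q₁ k)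
          - minOpL (H k) (Q k) * (Q₂ k)ᵀ * dEffForm (H k) (Q k) (H₁ k) (Q₁ k))
        + ((minOpL (H k) (Q k) * H₁ k - effForm (H k) (Q k) * Q₁ k) * dMinOp (H k) (Q k) (H₂ k) (Q₂ k)
          - minOpL (H k) (Q k) * (Q₁ k)ᵀ * dEffForm (H k) (Q k) (H₂ k) (Q₂ k))) (i k) (j k)‖ ≤
      25 * (2 * (4 * B / ρ)) ^ r' / (s₁ * r' ^ 2) * (25 * (2 * B) ^ r / (s₁ * r ^ 2) * c ^ (1 - r)) ^ (1 - r')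
        * ((θ ^ (1 - r)) ^ (1 - r')) ^ k := by
  have key := derivMixed_step_rateω
    (F := fun k (z : ℂ × ℂ) => effForm (H k + z.1 • H₁ k + z.2 • H₂ k) (Q k + z.1 • Q₁ k + z.2 • Q₂ k) (i k) (j k)) hs₁ hs₁ρ
    (fun k => differentiableOn_effForm_affine₂ (H k) (H₁ k) (H₂ k) (Q k) (Q₁ k) (Q₂ k) (hdet k) (i k) (j k)) hB hB0 hrate hc hθ
    hr hr1 hr' hr'1 k
  dsimp only at key
  rwa [deriv_deriv_effForm_affine₂ (H (k + 1)) (H₁ (k + 1)) (H₂ (k + 1)) (Q (k + 1)) (Q₁ (k + 1)) (Q₂ (k + 1))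
      (isUnit_det_base hs₁ hs₁ρ hdet (k + 1)),
    deriv_deriv_effForm_affine₂ (H k) (H₁ k) (H₂ k) (Q k) (Q₁ k) (Q₂ k) (isUnit_det_base hs₁ hs₁ρ hdet k)] at key

/-- **`exists_effFormJets_geometricRate` — THE ∃θ END OF ROUTE R6 FOR THE FINITE-DIMENSIONAL MODEL, IN an1's LETTERS** [our proof; PART 8
`exists_secondOrderJet_geometricRate` + PART 12]: under (S2) and (S1) as above (`0 < B`, `θ < 1`) there is ONE pair `(c″, θ″)`, `0 ≤ c″`, `0 ≤ θ″ < 1`,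
such that for every `k` the first B-jet rows of the effective form in BOTH bond directions, `dEffForm (H_k) (Q_k) (H₁) (Q₁) i j` and
`dEffForm (H_k) (Q_k) (H₂) (Q₂) i j`, AND the mixed two-vertex word `W_k` all obey `‖X_{k+1} − X_k‖ ≤ c″·θ″^k`. -/
theorem exists_effFormJets_geometricRate (hs₁ : 0 < s₁) (hs₁ρ : s₁ * Real.cosh 1 < ρ)
    (hdet : ∀ k, ∀ z ∈ ball (0 : ℂ) ρ ×ˢ ball (0 : ℂ) ρ,
      IsUnit (kkt (H k + z.1 • H₁ k + z.2 • H₂ k) (Q k + z.1 • Q₁ k + z.2 • Q₂ k)).det)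
    (hB : ∀ k, ∀ z ∈ ball (0 : ℂ) ρ ×ˢ ball (0 : ℂ) ρ,
      ‖effForm (H k + z.1 • H₁ k + z.2 • H₂ k) (Q k + z.1 • Q₁ k + z.2 • Q₂ k) (i k) (j k)‖ ≤ B) (hB0 : 0 < B)
    (hrate : ∀ k (s t : ℝ), 0 ≤ s → s ≤ s₁ → 0 ≤ t → t ≤ s₁ →
      ‖effForm (H (k + 1) + (s : ℂ) • H₁ (k + 1) + (t : ℂ) • H₂ (k + 1)) (Q (k + 1) + (s : ℂ) • Q₁ (k + 1) + (t : ℂ) • Q₂ (k + 1))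
          (i (k + 1)) (j (k + 1))
        - effForm (H k + (s : ℂ) • H₁ k + (t : ℂ) • H₂ k) (Q k + (s : ℂ) • Q₁ k + (t : ℂ) • Q₂ k) (i k) (j k)‖ ≤ c * θ ^ k)
    (hc : 0 < c) (hθ : 0 < θ) (hθ1 : θ < 1) :
    ∃ c'' θ'' : ℝ, 0 ≤ c'' ∧ 0 ≤ θ'' ∧ θ'' < 1 ∧ ∀ k,
      ‖dEffForm (H (k + 1)) (Q (k + 1)) (H₁ (k + 1)) (Q₁ (k + 1)) (i (k + 1)) (j (k + 1))
          - dEffForm (H k) (Q k) (H₁ k) (Q₁ k) (i k) (j k)‖ ≤ c'' * θ'' ^ k ∧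
      ‖dEffForm (H (k + 1)) (Q (k + 1)) (H₂ (k + 1)) (Q₂ (k + 1)) (i (k + 1)) (j (k + 1))
          - dEffForm (H k) (Q k) (H₂ k) (Q₂ k) (i k) (j k)‖ ≤ c'' * θ'' ^ k ∧
      ‖(((minOpL (H (k + 1)) (Q (k + 1)) * H₂ (k + 1) - effForm (H (k + 1)) (Q (k + 1)) * Q₂ (k + 1))
              * dMinOp (H (k + 1)) (Q (k + 1)) (H₁ (k + 1)) (Q₁ (k + 1))
            - minOpL (H (k + 1)) (Q (k + 1)) * (Q₂ (k + 1))ᵀ * dEffForm (H (k + 1)) (Q (k + 1)) (H₁ (k + 1)) (Q₁ (k + 1)))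
          + ((minOpL (H (k + 1)) (Q (k + 1)) * H₁ (k + 1) - effForm (H (k + 1)) (Q (k + 1)) * Q₁ (k + 1))
              * dMinOp (H (k + 1)) (Q (k + 1)) (H₂ (k + 1)) (Q₂ (k + 1))
            - minOpL (H (k + 1)) (Q (k + 1)) * (Q₁ (k + 1))ᵀ * dEffForm (H (k + 1)) (Q (k + 1)) (H₂ (k + 1)) (Q₂ (k + 1))))
            (i (k + 1)) (j (k + 1))
        - (((minOpL (H k) (Q k) * H₂ k - effForm (H k) (Q k) * Q₂ k) * dMinOp (H k) (Q k) (H₁ k) (Q₁ k)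
            - minOpL (H k) (Q k) * (Q₂ k)ᵀ * dEffForm (H k) (Q k) (H₁ k) (Q₁ k))
          + ((minOpL (H k) (Q k) * H₁ k - effForm (H k) (Q k) * Q₁ k) * dMinOp (H k) (Q k) (H₂ k) (Q₂ k)
            - minOpL (H k) (Q k) * (Q₁ k)ᵀ * dEffForm (H k) (Q k) (H₂ k) (Q₂ k))) (i k) (j k)‖ ≤ c'' * θ'' ^ k := by
  obtain ⟨c'', θ'', h0, h1, h2, hk⟩ := exists_secondOrderJet_geometricRate
    (F := fun k (z : ℂ × ℂ) => effForm (H k + z.1 • H₁ k + z.2 • H₂ k) (Q k + z.1 • Q₁ k + z.2 • Q₂ k) (i k) (j k)) hs₁ hs₁ρ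
    (fun k => differentiableOn_effForm_affine₂ (H k) (H₁ k) (H₂ k) (Q k) (Q₁ k) (Q₂ k) (hdet k) (i k) (j k)) hB hB0 hrate hc hθ hθ1
  refine ⟨c'', θ'', h0, h1, h2, fun k => ?_⟩
  obtain ⟨r1, r2, r3, -⟩ := hk k
  dsimp only at r1 r2 r3
  rw [deriv_effForm_fst (H (k + 1)) (H₁ (k + 1)) (H₂ (k + 1)) (Q (k + 1)) (Q₁ (k + 1)) (Q₂ (k + 1)) (isUnit_det_base hs₁ hs₁ρ hdet (k + 1)),
    deriv_effForm_fst (H k) (H₁ k) (H₂ k) (Q k) (Q₁ k) (Q₂ k) (isUnit_det_base hs₁ hs₁ρ hdet k)] at r1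
  rw [deriv_effForm_snd (H (k + 1)) (H₁ (k + 1)) (H₂ (k + 1)) (Q (k + 1)) (Q₁ (k + 1)) (Q₂ (k + 1)) (isUnit_det_base hs₁ hs₁ρ hdet (k + 1)),
    deriv_effForm_snd (H k) (H₁ k) (H₂ k) (Q k) (Q₁ k) (Q₂ k) (isUnit_det_base hs₁ hs₁ρ hdet k)] at r2
  rw [deriv_deriv_effForm_affine₂ (H (k + 1)) (H₁ (k + 1)) (H₂ (k + 1)) (Q (k + 1)) (Q₁ (k + 1)) (Q₂ (k + 1))
      (isUnit_det_base hs₁ hs₁ρ hdet (k + 1)),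
    deriv_deriv_effForm_affine₂ (H k) (H₁ k) (H₂ k) (Q k) (Q₁ k) (Q₂ k) (isUnit_det_base hs₁ hs₁ρ hdet k)] at r3
  exact ⟨r1, r2, r3⟩

end End

end Summit.QuantumFields.BalabanUV.Beta.GAN24.DerivativeRateTransferAnalyticKKTEnd

end
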